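import Mathlib
import HarnessLib
import Summits.HubbardSuperconductivity.HubbardSuperconductivity.Theorems.KLProgrammeKLRegimeCountertermGateInductionUpTo
import Summits.HubbardSuperconductivity.HubbardSuperconductivity.Theorems.KLProgrammeKLRegimeCountertermPicardContraction
import Summits.HubbardSuperconductivity.HubbardSuperconductivity.Theorems.KLProgrammeKLRegimeCountertermMultiSlotSelfMap

/-!
# Route `KLProgramme` — the Counterterm child of crux K3 (gen-3 item stmt-HubbardSuperconductivity-19825 `KLRegimeCountertermV11`):
# THE ONE-LEVEL STEP of the one-volume construction — from an admissible frame `F` renormalised below `n` with a small top partial sum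
# to `F′ := P^G(F) ⊖ D_n^G(F)`, admissible, renormalised at every scale `≤ n`, with a small top partial sum
# (seat hubbard-kl-k3c3-p1, part I; the induction step of the level recursion `K^{(n)} = Φ_n K^{(n−1)}`)

Fixed: the V11 hypothesis block `hyp : CtHypMsV11 G P Q β U μ Lh Mh`, one volume `(L, M)` beyond the thresholds, `μ` on the covariance window,
the five threshold conditions of `frameOK_of_multiSlot` (p2's `ctRenMs_thresholds`), the GATE in applied form (part H′
`renormalisedAtF_upTo_of_partialSums` specialised to the regime, with its wiggle constant `w`), and a bound `qq ≥ Σ_{i ≤ j} lipBar G Q U i`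
with `32·qq ≤ 1`.  Writing `b i := twoLegBar G Q U 0 i` and `tol j := ctCr G·|U|·Λ_j²/e₀`:

**`levelStep`.**  If `F` is admissible (`FrameOK (ctRenMs G) U (nScales β) μ F`), renormalised at every `j < n` (`n ≤ nScales β`), and its
level-`(n−1)` partial sum is small, `|F(q) + Σ_{i<n} ℓ_i^G(F)(q)| ≤ 2·qq·16·b n` (for `n = 0`: `|F| ≤ 2·qq·16·b 0`, e.g. `F = 0`), and the
tolerance arithmetic `2·qq·b n + Σ_{i ∈ Ico (j+1)(n+1)} b i + w ≤ tol j` holds for `j ≤ n`, then `F′ := fsub (klFrameProjG L μ F)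
(klTwoLegPolyG L M β U μ F n)` is admissible, renormalised at every `j ≤ n`, `frameDist F′ F ≤ 2·b n`, ALL its partial sums are bounded, `|F′(q) + Σ_{i≤j} ℓ_i^G(F′)(q)| ≤ 2·qq·b n + Σ_{j<i≤n} b i` (`j ≤ n`), and
in particular `|F′(q) + Σ_{i≤n} ℓ_i^G(F′)(q)| ≤ 2·qq·b n ≤ 2·qq·16·b (n+1)` — the same shape one level up.

Ingredients: `frameOK_of_multiSlot` (k3c3-p2) with (E3a-MS) at `F` (`CtHypMsV11.twoLegSizesMS`); part F (`eval_counterImage`,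
`abs_eval_counterImage_add_partialSum_le`); part G (`abs_piece_response_le` with the comparison frame `F`, whose history below `n` is
`CtHypMsV11.rateAntecedent`); part H′ (the gate up to level `n`).  Proofs only; nothing is asserted about the Hubbard model.
-/

noncomputable section

namespace Summit.HubbardSuperconductivity.HubbardSuperconductivity.Theorems.KLRegimeSplit

set_option linter.dupNamespace false -- summit = problem name (single-conjunct summit), D-0017

open Real Finset
open Literature.MathematicalPhysics.QuantumLattice Literature.Probability.LatticeModels
open Summit.HubbardSuperconductivity.HubbardSuperconductivity.Theorems.KLProgrammeLegKernels

section Model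

variable {L M : ℕ} [NeZero L] [NeZero M]

/-- **Order-0 size of a G-piece as a sup bound**: (E3a-G) tier 1 at `j = 0` gives `|ℓ_n^G(K)(p)| ≤ twoLegBar G Q U 0 n` at every `p`. -/
theorem abs_eval_klTwoLegPieceG_le_of_sizes {G : GeoConsts} {Q : EngConsts} {R : RenConsts} {β U μ : ℝ} {K : TrigPolyC4v} {n : ℕ}
    (h : TwoLegSizesG L M G Q R β U μ K n) (p : Fin 2 → ℝ) :
    |(klTwoLegPieceG L M β U μ K n).eval p| ≤ twoLegBar G Q U 0 n := by
  have h0 := h.1 0 (by norm_num) (WithLp.toLp 2 p)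
  rw [norm_iteratedFDeriv_zero, Real.norm_eq_abs] at h0
  exact h0

/-- `b_{n} = 16·b_{n+1}` for the order-0 majorants. -/
theorem twoLegBar_zero_succ (G : GeoConsts) (Q : EngConsts) (U : ℝ) (n : ℕ) :
    twoLegBar G Q U 0 n = 16 * twoLegBar G Q U 0 (n + 1) := by
  rw [twoLegBar_zero_eq, twoLegBar_zero_eq, pow_succ]
  ring

/-- The invariant one level up: `2·qq·b n = 2·qq·(16·b (n+1))`. -/
theorem levelStep_invariant_up (G : GeoConsts) (Q : EngConsts) (U qq : ℝ) (n : ℕ) :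
    2 * qq * twoLegBar G Q U 0 n ≤ 2 * qq * (16 * twoLegBar G Q U 0 (n + 1)) := by
  rw [← twoLegBar_zero_succ]

variable {G : GeoConsts} {P : SplitConsts} {Q : EngConsts} (hG : G.WF) (hQ : Q.WF) {β U μ : ℝ} (hμ : μ ∈ Set.Icc (-1.05 : ℝ) (-0.15))
  {Lh : ℕ} {Mh : ℕ → ℕ} (hyp : CtHypMsV11 G P Q β U μ Lh Mh) (hLh : Lh ≤ L) (hMh : Mh L ≤ M)
  -- the five threshold conditions of `frameOK_of_multiSlot` at `R = ctRenMs G`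
  (ha : ∀ j ≤ 4, 2 * (G.S j + Q.S' j * |U|) ≤ (ctRenMs G).Gfr j)
  (hb : ∀ n : ℕ, ∑ i ∈ range (n + 1), msBar G Q U i ≤ 1 / 2)
  (h0 : ∑ m ∈ range (nScales β + 1), (ctRenMs G).Gfr 0 * uPow 0 U * (4 : ℝ) ^ (((0 : ℤ) - 2) * m) ≤ 3 / 80)
  (h1 : ∑ m ∈ range (nScales β + 1), (ctRenMs G).Gfr 1 * uPow 1 U * (4 : ℝ) ^ (((1 : ℤ) - 2) * m) ≤ 1 / 2000)
  (h2 : ∑ m ∈ range (nScales β + 1), ∑ j ∈ range 3,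
      (ctRenMs G).Gfr j * uPow j U * (4 : ℝ) ^ (((j : ℤ) - 2) * m) ≤ 1 / 100)
  -- the contraction bound
  {qq : ℝ} (hqq0 : 0 ≤ qq) (hqq : ∀ n : ℕ, ∑ i ∈ range (n + 1), lipBar G Q U i ≤ qq) (hqq32 : 32 * qq ≤ 1)
  -- the gate (part H′ specialised to the regime and the volume), with its wiggle constant `w`
  {w : ℝ}
  (gate : ∀ K : TrigPolyC4v, FrameOK (ctRenMs G) U (nScales β) μ K → ∀ n ≤ nScales β, ∀ B : ℕ → ℝ,
    (∀ j ≤ n, (∀ i < j, RenormalisedAtF L M β U μ K (ctRenMs G) i) →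
      ∀ q : Fin 2 → ℝ, |K.eval q + ∑ i ∈ range (j + 1), (klTwoLegPieceG L M β U μ K i).eval q| ≤ B j) →
    (∀ j ≤ n, B j + w ≤ ctCr G * |U| * klScale klE0 j ^ 2 / klE0) →
    ∀ j ≤ n, RenormalisedAtF L M β U μ K (ctRenMs G) j)

include hG hQ hμ hyp hLh hMh ha hb h0 h1 h2 hqq0 hqq hqq32 gate

/-- **THE ONE-LEVEL STEP.**  See the module docstring. -/
theorem levelStep {n : ℕ} (hn : n ≤ nScales β) {F : TrigPolyC4v} (hF : FrameOK (ctRenMs G) U (nScales β) μ F)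
    (hrenF : ∀ j < n, RenormalisedAtF L M β U μ F (ctRenMs G) j)
    (hSF : ∀ q : Fin 2 → ℝ, |F.eval q + ∑ i ∈ range n, (klTwoLegPieceG L M β U μ F i).eval q| ≤
      2 * qq * (16 * twoLegBar G Q U 0 n))
    (htol : ∀ j ≤ n, 2 * qq * twoLegBar G Q U 0 n + ∑ i ∈ Ico (j + 1) (n + 1), twoLegBar G Q U 0 i + w ≤
      ctCr G * |U| * klScale klE0 j ^ 2 / klE0) :
    FrameOK (ctRenMs G) U (nScales β) μ (fsub (klFrameProjG L μ F) (klTwoLegPolyG L M β U μ F n)) ∧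
    (∀ j ≤ n, RenormalisedAtF L M β U μ (fsub (klFrameProjG L μ F) (klTwoLegPolyG L M β U μ F n)) (ctRenMs G) j) ∧
    frameDist (fsub (klFrameProjG L μ F) (klTwoLegPolyG L M β U μ F n)) F ≤ 2 * twoLegBar G Q U 0 n ∧
    (∀ j ≤ n, ∀ q : Fin 2 → ℝ, |(fsub (klFrameProjG L μ F) (klTwoLegPolyG L M β U μ F n)).eval q +
        ∑ i ∈ range (j + 1), (klTwoLegPieceG L M β U μ (fsub (klFrameProjG L μ F) (klTwoLegPolyG L M β U μ F n)) i).eval q| ≤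
      2 * qq * twoLegBar G Q U 0 n + ∑ i ∈ Ico (j + 1) (n + 1), twoLegBar G Q U 0 i) ∧
    (∀ q : Fin 2 → ℝ, |(fsub (klFrameProjG L μ F) (klTwoLegPolyG L M β U μ F n)).eval q +
        ∑ i ∈ range (n + 1), (klTwoLegPieceG L M β U μ (fsub (klFrameProjG L μ F) (klTwoLegPolyG L M β U μ F n)) i).eval q| ≤
      2 * qq * twoLegBar G Q U 0 n) := by
  set F' := fsub (klFrameProjG L μ F) (klTwoLegPolyG L M β U μ F n) with hF'def
  have hR : ∀ j, 0 ≤ (ctRenMs G).Gfr j := ctRenMs_Gfr_nonneg hG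
  have hS0 : 0 ≤ G.S 0 + Q.S' 0 * |U| := by
    have := hG.2.2.2.2.2.2.2.2.2.2.2.2.2.2.2.2.2.1 0; have := hQ.2.2.2.2.1 0; positivity
  have hb0 : ∀ i, 0 ≤ twoLegBar G Q U 0 i := fun i => by rw [twoLegBar_zero_eq]; positivity
  set bn := twoLegBar G Q U 0 n with hbn
  -- (1) the slots at `F` for the scales `i ≤ n`
  have hstepF : ∀ i ≤ n, TwoLegStepG L M (histV10 L M G P Q (ctRenMs G) β U μ) G P Q (ctRenMs G) β U μ F i := fun i hi =>
    hyp.twoLegStepG hF hLh hMh (hi.trans hn) fun j hj => hrenF j (lt_of_lt_of_le hj hi)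
  have hMS : ∀ i ≤ n, TwoLegSizesMS L M G Q (ctRenMs G) β U μ F i := fun i hi =>
    hyp.twoLegSizesMS hF hLh hMh (hi.trans hn) fun j hj => hrenF j (lt_of_lt_of_le hj hi)
  -- (2) admissibility of `F′`
  have hF' : FrameOK (ctRenMs G) U (nScales β) μ F' :=
    frameOK_of_multiSlot hG hQ hR hn hμ hMS ha (hb n) h0 h1 h2
  -- (3) the distance `frameDist F′ F ≤ |top partial sum of F| + b n ≤ 2 b n`
  have hbn_le : ∀ q : Fin 2 → ℝ, |(klTwoLegPieceG L M β U μ F n).eval q| ≤ bn := fun q =>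
    abs_eval_klTwoLegPieceG_le_of_sizes (hstepF n le_rfl).1 q
  have hdist_pt : ∀ q : Fin 2 → ℝ, |F'.eval q - F.eval q| ≤ 2 * qq * (16 * bn) + bn := by
    intro q
    rw [hF'def, eval_counterImage, sum_range_succ]
    have e : -(∑ i ∈ range n, (klTwoLegPieceG L M β U μ F i).eval q + (klTwoLegPieceG L M β U μ F n).eval q) - F.eval q =
        -((F.eval q + ∑ i ∈ range n, (klTwoLegPieceG L M β U μ F i).eval q) + (klTwoLegPieceG L M β U μ F n).eval q) := by
      ring
    rw [e, abs_neg]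
    exact (abs_add_le _ _).trans (add_le_add (hSF q) (hbn_le q))
  have hd2 : 2 * qq * (16 * bn) + bn ≤ 2 * bn := by nlinarith [hb0 n]
  have hdist : frameDist F' F ≤ 2 * bn := frameDist_le_of_forall fun q => (hdist_pt q).trans hd2
  -- (4) the conditional sup bounds of the partial sums of `F′`, `j ≤ n`
  have hB : ∀ j ≤ n, (∀ i < j, RenormalisedAtF L M β U μ F' (ctRenMs G) i) →
      ∀ q : Fin 2 → ℝ, |F'.eval q + ∑ i ∈ range (j + 1), (klTwoLegPieceG L M β U μ F' i).eval q| ≤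
        (∑ i ∈ range (j + 1), lipBar G Q U i) * frameDist F' F + ∑ i ∈ Ico (j + 1) (n + 1), twoLegBar G Q U 0 i := by
    intro j hj hrenF' q
    -- (E3c-G) at `F′` for the scales `i ≤ j`, against the comparison frame `F` (admissible, history below `j`)
    have hLip : ∀ i ≤ j, FrameLipschitzG L M (histV10 L M G P Q (ctRenMs G) β U μ) G Q (ctRenMs G) β U μ F' i := fun i hi =>
      (hyp.twoLegStepG hF' hLh hMh (hi.trans (hj.trans hn)) fun i' hi' => hrenF' i' (lt_of_lt_of_le hi' hi)).2.2.1
    have hhistF : ∀ i < j, histV10 L M G P Q (ctRenMs G) β U μ F i := fun i hi =>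
      (hyp.rateAntecedent hF hLh hMh (hj.trans hn) (fun i' hi' => hrenF i' (lt_of_lt_of_le hi' hj)) i hi).1
    have hresp := abs_piece_response_le L M hLip hF hhistF
    exact abs_eval_counterImage_add_partialSum_le L M β U μ F hj hresp
      (fun i hji hin q' => abs_eval_klTwoLegPieceG_le_of_sizes (hstepF i hin).1 q') q
  -- (5) the gate: renormalisation of `F′` at every `j ≤ n`
  have hB' : ∀ j ≤ n, (∀ i < j, RenormalisedAtF L M β U μ F' (ctRenMs G) i) →
      ∀ q : Fin 2 → ℝ, |F'.eval q + ∑ i ∈ range (j + 1), (klTwoLegPieceG L M β U μ F' i).eval q| ≤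
        2 * qq * bn + ∑ i ∈ Ico (j + 1) (n + 1), twoLegBar G Q U 0 i := by
    intro j hj hrenF' q
    refine (hB j hj hrenF' q).trans ?_
    have h1 : (∑ i ∈ range (j + 1), lipBar G Q U i) * frameDist F' F ≤ qq * (2 * bn) :=
      mul_le_mul (hqq j) hdist (frameDist_nonneg _ _) hqq0
    linarith
  have hrenF' : ∀ j ≤ n, RenormalisedAtF L M β U μ F' (ctRenMs G) j :=
    gate F' hF' n hn (fun j => 2 * qq * bn + ∑ i ∈ Ico (j + 1) (n + 1), twoLegBar G Q U 0 i) hB'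
      (fun j hj => by have := htol j hj; linarith)
  -- (6) the top partial sum of `F′`
  have htop : ∀ q : Fin 2 → ℝ, |F'.eval q + ∑ i ∈ range (n + 1), (klTwoLegPieceG L M β U μ F' i).eval q| ≤ 2 * qq * bn := by
    intro q
    have h := hB' n le_rfl (fun i hi => hrenF' i (le_of_lt hi)) q
    rwa [Ico_self, sum_empty, add_zero] at h
  exact ⟨hF', hrenF', hdist, fun j hj q => hB' j hj (fun i hi => hrenF' i ((le_of_lt hi).trans hj)) q, htop⟩

end Model

end Summit.HubbardSuperconductivity.HubbardSuperconductivity.Theorems.KLRegimeSplit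

end
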